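import Summits.BirchSwinnertonDyer.BirchSwinnertonDyer.Theorems.KolyvaginDepthDoorDepthTableKurihara
import Literature.NumberTheory.EllipticCurves.LocalTorsionDivisionPolynomialCertificateAnyPrime
import Literature.NumberTheory.EllipticCurves.KuriharaNumberKimShaLengthLocalTorsionTrivial
import HarnessLib

/-!
# Route `KolyvaginDepthDoor`, crux `KolyvaginDepthSupplyKN` (stmt-BirchSwinnertonDyer-22820) —
# DEPTH TABLE v24, GENERIC: «THE ANOMALOUS PRIME» — the E-side bit `Ш(E/ℚ)[p] = 0` from ONE unit mod-`p`
# Kurihara number at an ANOMALOUS good ordinary prime (`a_p ≡ 1 (mod p)`), under Kim's hypothesis (iii)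
# AS PRINTED, `E(ℚ_p)[p] = 0`, discharged per curve by the tree's division-polynomial certificate

Helper file of the lead prover of line `levelone` (kdd-p1 g28; `--supports stmt-BirchSwinnertonDyer-22820
--as helper`); it closes nothing and BSD is NOT proved by it.

WHY. Every E-side reading of the depth table since v17 (`natCard_selmerGroup_le_pow_of_kuriharaClaim`,
`sha_inf_torsionBy_eq_bot_of_kuriharaClaim`, the decisive pair / tuple) carries the hypothesis
`hna : ¬ p ∣ a_p − 1` («`p` non-anomalous»), used for ONE purpose: to produce Kim's hypothesis (iii)
`E(ℚ_p)[p] = 0` by the point count (AEC VII.2.1/VII.3.1, tree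
`localTorsion_eq_zero_of_good_of_not_dvd_frobeniusTrace_sub_one`). But C.-H. Kim, Amer. J. Math. 148
(2026), Thm. 1.11 is printed with (iii) `E(ℚ_p)[p] = 0` — WEAKER than non-anomalous: at an anomalous good
prime `E(ℚ_p)[p]` vanishes unless `ρ̄|_{G_{ℚ_p}}` splits (Kim, Prop. 3.2), a finite computation the tree
already turns into the binder (`natCard_localPTorsion_eq_one_of_certificate_zmod`: `preΨ'_p(E₀)` has no
zero in `ℤ/p^k`, ONE `decide`; files `LocalTorsionDivisionPolynomialCertificate{Proofs,AnyPrime}`). So the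
tree's transcription `Kim2022_card_selmerGroup_le_pow_of_kuriharaNumber_ne_zero` (binder
`∀ P ∈ E(ℚ_p), p • P = O → P = O`) applies VERBATIM at such primes, and the table's 7 anomalous rank-two
records `N < 1000` (g26 AGREEMENT-TEST-v22 §1: 433a1, 446d1, 563a1, 664a1, 681c1, 794a1, 997b1 @ `p = 5`,
«facts silent») and the anomalous depth-two / depth-three records beyond are NOT outside print: v24 reads
them ONE WAY («unit ⟹ `Ш(E)[p] = 0`»). The other direction (Sakamoto 2022 L4.4/L4.6, `hSakR`) is printed
under `p ∤ #Ẽ(𝔽_p)` and is NOT claimed here.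

CONTENTS (theorems only; no new named fact).
* §1 `natCard_selmerGroup_le_pow_of_kuriharaClaim_of_localTorsionTrivial` — v17's E-side bound with
  `hna` replaced by the printed binder `ht0 : ∀ P ∈ E(ℚ_p), p • P = O → P = O`;
  `sha_inf_torsionBy_eq_bot_of_kuriharaClaim_of_localTorsionTrivial` — the bit at `ν(n) ≤ rank`.
* §2 `localTorsionTrivial_of_certificate_zmod` — the binder for the literal model
  `E₀ ⊗ ℚ` from the modular certificate (`PrePsiEval.prePsi` over `ℤ/p^k`, `decide`-able), in the
  `∀ P, (p : ℤ) • P = 0 → P = 0` currency of §1; `localTorsionTrivial_of_nonAnomalous` — the old route is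
  the special case (so §1 generalises v17, same conclusion).
* §3 `sha_inf_torsionBy_eq_bot_of_kuriharaClaim_of_certificate_zmod` — §1 + §2 composed for a literal
  integral model: the shape the per-curve anomalous rows instantiate.

CONDITIONAL on the named facts displayed as hypotheses (`hKim`, `hnf`, `hMaz`) and on the Kurihara CLAIM;
per `(W, p, n)`; nothing class-wide (the open stub (S♭) is untouched); BSD is NOT proved by any of this.

References: [Kim2022StructureSelmer] C.-H. Kim, Amer. J. Math. 148 (2026) = arXiv:2203.12159, Thm. 1.11
(hypothesis (iii)), §3.1.1, Prop. 3.2 (PDF p. 15); [SilvermanAEC2009] Exercise 3.7 (f), VII.2.1, VII.3.1,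
IV.6.1, X.4.2; [Mazur1978] Cor. 4.1; [Kurihara2014] Thm. 1.2.3 (1).
-/

set_option linter.dupNamespace false

noncomputable section

open scoped Classical NumberField

namespace Summit.BirchSwinnertonDyer.BirchSwinnertonDyer.Theorems.KolyvaginDepthDoor

open Literature.NumberTheory.EllipticCurves Literature.NumberTheory.EllipticCurves.ModularForms
  WeierstrassCurve NumberField IsDedekindDomain
open Summit.BirchSwinnertonDyer.BirchSwinnertonDyer.Theorems

/-! ## §1 The E-side at a prime with `E(ℚ_p)[p] = 0` (Kim's hypothesis (iii) as printed) -/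

/-- **E-SIDE: `#Sel_p(E/ℚ) ≤ p^{ν(n)}` from ONE unit mod-`p` Kurihara number at a cyclic level `n`, under
`E(ℚ_p)[p] = 0` AS PRINTED (anomalous primes allowed).** `W` globally minimal elliptic; `p ≥ 5` good
ordinary with `ρ̄_{E,p}` onto; `ht0 : E(ℚ_p)[p] = 0` (Kim's hypothesis (iii) verbatim — at a non-anomalous
prime it is automatic, at an anomalous one it is the division-polynomial certificate of §2); `p ∤ ord_v(Δ_min)`
at every multiplicative place (⟹ `p ∤ Tam(E)`); `n` a cyclic Kolyvagin level; the CLAIM `hδ` (shape of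
`KuriharaCertificates.Record.Claim`). The datum with `p ∤ c_D` exists by modularity + Mazur 1978 Cor. 4.1 +
Néron scaling, the period transfer by Mazur's corollary, and Kim's Theorem 1.11 (`hKim`) concludes — the proof
of v17's `natCard_selmerGroup_le_pow_of_kuriharaClaim` with the point-count step removed. CONDITIONAL on the
three named facts and the claim; BSD is not proved by it. [cite: Kim2022StructureSelmer, Thm. 1.11 with hypothesis (iii) (PDF p. 8), Prop. 3.2 (PDF p. 15)]
[cite: Mazur1978, Cor. 4.1] -/
theorem natCard_selmerGroup_le_pow_of_kuriharaClaim_of_localTorsionTrivial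
    (hKim : Literature.NumberTheory.EllipticCurves.Kim2022_card_selmerGroup_le_pow_of_kuriharaNumber_ne_zero)
    (hnf : exists_isNewformOf) (hMaz : mazur_not_dvd_maninConstant_of_odd)
    (W : WeierstrassCurve ℚ) [W.IsElliptic] [W.IsGloballyMinimal] (p : ℕ) [hp : Fact p.Prime] (h5 : 5 ≤ p)
    (hgood : W.HasGoodReductionAtPrime p) (hord : ¬ (p : ℤ) ∣ W.frobeniusTrace p)
    (hsur : W.HasSurjectiveModNGaloisRep p)
    (ht0 : ∀ P : (W.baseChange ℚ_[p]).toAffine.Point, (p : ℤ) • P = 0 → P = 0)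
    (hKN : ∀ v : HeightOneSpectrum (𝓞 ℚ), W.HasMultiplicativeReductionAt v → ¬ p ∣ W.ordMinimalDiscriminant v)
    [iNZ : NeZero (W.conductorNorm ℤ)] (n : ℕ) [NeZero n] (hn : IsCyclicKolyvaginLevel W p n)
    (hδ : ∀ (D : ModularParametrizationData W (W.conductorNorm ℤ)), ¬ (p : ℤ) ∣ D.maninConstant →
      (∃ u : ℚ, ‖(u : ℚ_[p])‖ = 1 ∧ W.realPeriodRat = u * plusPeriod D.f) →
      ∃ ψ : (ℓ : ℕ) → (ZMod ℓ)ˣ →* Multiplicative (ZMod p),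
        (∀ ℓ ∈ n.primeFactors, Function.Surjective (ψ ℓ)) ∧ kuriharaNumber D.f p n ψ ≠ 0) :
    Nat.card (W.selmerGroup p) ≤ p ^ n.primeFactors.card := by
  have hpP : p.Prime := hp.out
  have hp2 : p ≠ 2 := by omega
  haveI : NeZero (p : ℚ) := ⟨by exact_mod_cast hpP.ne_zero⟩
  have hirr : W.HasIrreducibleModPGaloisRep p := hasIrreducibleModPGaloisRep_of_hasSurjectiveModNGaloisRep W p hsur
  -- the datum with `p ∤ c_D` (modularity + Mazur + Néron scaling)
  have hpN : ¬ p ^ 2 ∣ W.conductorNorm ℤ := fun h ↦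
    not_dvd_conductorNorm_of_hasGoodReductionAtPrime W hgood (dvd_trans (dvd_pow_self p two_ne_zero) h)
  obtain ⟨D, hD⟩ := Summit.BirchSwinnertonDyer.Rank1Residual.X11b.exists_modularParametrizationData_not_dvd hnf hMaz
    integral_neronScaling_of_isGloballyMinimal_holds W rfl hpP hp2 hpN hirr
  have hc : ¬ (p : ℤ) ∣ D.maninConstant := hD
  -- the period transfer (Mazur's corollary again)
  have hu : ∃ u : ℚ, ‖(u : ℚ_[p])‖ = 1 ∧ W.realPeriodRat = u * plusPeriod D.f :=
    SkinnerUrban2014.realPeriodRat_eq_unit_mul_plusPeriod_of_mazur hMaz W p h5 hgood hirr D.f D.isNewformOf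
  -- `p ∤ Tam(E)` (Kodaira–Néron)
  have htam : ¬ p ∣ W.tamagawaProduct := not_dvd_tamagawaProduct_of_kodairaNeron W p h5 hKN
  obtain ⟨ψ, hψ, hne⟩ := hδ D hc hu
  exact hKim W p h5 ⟨hgood, hord⟩ hsur ht0 htam D hc hu n hn ψ hψ hne

/-- **E-SIDE BIT under `E(ℚ_p)[p] = 0` as printed: `Ш(E/ℚ)[p] = 0` from ONE unit Kurihara number at a cyclic
level of depth `ν(n) ≤ rank_ℤ E(ℚ)`** — §1 + the descent count
(`sha_inf_torsionBy_eq_bot_of_natCard_selmerGroup_le`). At an ANOMALOUS good ordinary prime this is the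
only printed direction (Sakamoto's converse is stated under `p ∤ #Ẽ(𝔽_p)`). CONDITIONAL on `hKim`,
modularity, Mazur and the claim; BSD is not proved by it. [cite: Kim2022StructureSelmer, Thm. 1.11 with hypothesis (iii) (PDF p. 8)]
[cite: SilvermanAEC2009, Thm. X.4.2] -/
theorem sha_inf_torsionBy_eq_bot_of_kuriharaClaim_of_localTorsionTrivial
    (hKim : Literature.NumberTheory.EllipticCurves.Kim2022_card_selmerGroup_le_pow_of_kuriharaNumber_ne_zero)
    (hnf : exists_isNewformOf) (hMaz : mazur_not_dvd_maninConstant_of_odd)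
    (W : WeierstrassCurve ℚ) [W.IsElliptic] [W.IsGloballyMinimal] (p : ℕ) [hp : Fact p.Prime] (h5 : 5 ≤ p)
    (hgood : W.HasGoodReductionAtPrime p) (hord : ¬ (p : ℤ) ∣ W.frobeniusTrace p)
    (hsur : W.HasSurjectiveModNGaloisRep p)
    (ht0 : ∀ P : (W.baseChange ℚ_[p]).toAffine.Point, (p : ℤ) • P = 0 → P = 0)
    (hKN : ∀ v : HeightOneSpectrum (𝓞 ℚ), W.HasMultiplicativeReductionAt v → ¬ p ∣ W.ordMinimalDiscriminant v)
    [iNZ : NeZero (W.conductorNorm ℤ)] (n : ℕ) [NeZero n] (hn : IsCyclicKolyvaginLevel W p n)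
    (hν : n.primeFactors.card ≤ W.mordellWeilRank)
    (hδ : ∀ (D : ModularParametrizationData W (W.conductorNorm ℤ)), ¬ (p : ℤ) ∣ D.maninConstant →
      (∃ u : ℚ, ‖(u : ℚ_[p])‖ = 1 ∧ W.realPeriodRat = u * plusPeriod D.f) →
      ∃ ψ : (ℓ : ℕ) → (ZMod ℓ)ˣ →* Multiplicative (ZMod p),
        (∀ ℓ ∈ n.primeFactors, Function.Surjective (ψ ℓ)) ∧ kuriharaNumber D.f p n ψ ≠ 0) :
    (W.sha ⊓ AddSubgroup.torsionBy W.galH1 (p : ℤ) : AddSubgroup W.galH1) = ⊥ :=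
  sha_inf_torsionBy_eq_bot_of_natCard_selmerGroup_le W p
    ((natCard_selmerGroup_le_pow_of_kuriharaClaim_of_localTorsionTrivial hKim hnf hMaz W p h5 hgood hord hsur ht0
      hKN n hn hδ).trans (Nat.pow_le_pow_right hp.out.pos hν))

/-! ## §2 The binder `E(ℚ_p)[p] = 0` for a literal integral model: certificate form and the old route -/

/-- **`E(ℚ_p)[p] = 0` for the rational curve of an integral equation `E₀` from the MODULAR division-polynomial
certificate** (`preΨ'_p(E₀ ⊗ ℤ/p^k)` nowhere zero on `ℤ/p^k`, computed by `PrePsiEval.prePsi` — ONE `decide`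
for explicit `E₀, p, k`; in practice `k = 2`), in the `(p : ℤ) • P = 0 → P = 0` currency of Kim's binder
(tree `natCard_localPTorsion_eq_one_of_certificate_zmod` + `natCard_localPTorsion_eq_one_iff`).
[cite: SilvermanAEC2009, Exercise 3.7 (f) and VII.3 Prop. 3.1 (with IV.6 Thm. 6.1)]
[cite: Kim2022StructureSelmer, Prop. 3.2 (PDF p. 15)] -/
theorem localTorsionTrivial_of_certificate_zmod (W₀ : WeierstrassCurve ℤ) (p : ℕ) [Fact p.Prime]
    (hp3 : 3 ≤ p) [(W₀.map (Int.castRingHom ℚ)).IsElliptic] (k : ℕ)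
    (hcert : ∀ z : ℕ, z < p ^ k →
      PrePsiEval.prePsi (W₀.map (Int.castRingHom (ZMod (p ^ k)))) (z : ZMod (p ^ k)) p ≠ 0) :
    ∀ P : ((W₀.map (Int.castRingHom ℚ)).baseChange ℚ_[p]).toAffine.Point, (p : ℤ) • P = 0 → P = 0 :=
  (natCard_localPTorsion_eq_one_iff _ p).mp
    (natCard_localPTorsion_eq_one_of_certificate_zmod W₀ p hp3 _ rfl k hcert)

/-- **The old route is a special case**: at a GOOD NON-ANOMALOUS prime (`p ≥ 3`, `p ∤ a_p − 1`) the binder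
`E(ℚ_p)[p] = 0` holds by the point count (AEC VII.2.1/VII.3.1; tree
`localTorsion_eq_zero_of_good_of_not_dvd_frobeniusTrace_sub_one`), so §1 contains v17's
`natCard_selmerGroup_le_pow_of_kuriharaClaim`. [cite: SilvermanAEC2009, VII.3 Prop. 3.1]
[cite: Kim2022StructureSelmer, §3.1.1 (PDF p. 15)] -/
theorem localTorsionTrivial_of_nonAnomalous (W : WeierstrassCurve ℚ) [W.IsElliptic] [W.IsGloballyMinimal]
    (p : ℕ) [Fact p.Prime] (hp3 : 3 ≤ p) (hgood : W.HasGoodReductionAtPrime p)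
    (hna : ¬ (p : ℤ) ∣ W.frobeniusTrace p - 1) :
    ∀ P : (W.baseChange ℚ_[p]).toAffine.Point, (p : ℤ) • P = 0 → P = 0 := fun P hP ↦
  localTorsion_eq_zero_of_good_of_not_dvd_frobeniusTrace_sub_one W p hp3 hgood hna P
    (by rw [← natCast_zsmul]; exact hP)

/-! ## §3 The composed shape for a literal integral model (what the anomalous rows instantiate) -/

/-- **THE ANOMALOUS ROW MECHANISM: `Ш(E/ℚ)[p] = 0` ⟸ ONE unit Kurihara number at a cyclic level with
`ν(n) ≤ rank`, for the rational curve of an integral GLOBALLY MINIMAL equation `E₀`, at a good ordinary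
`p ≥ 5` with `ρ̄` onto and Kodaira–Néron, the binder `E(ℚ_p)[p] = 0` being the `decide`-able modular
certificate of §2** (no «non-anomalous» hypothesis). CONDITIONAL on `hKim`, modularity, Mazur and the claim;
per curve; BSD is not proved by it. [cite: Kim2022StructureSelmer, Thm. 1.11 with hypothesis (iii) (PDF p. 8), Prop. 3.2]
[cite: SilvermanAEC2009, Exercise 3.7 (f), Thm. X.4.2] -/
theorem sha_inf_torsionBy_eq_bot_of_kuriharaClaim_of_certificate_zmod
    (hKim : Literature.NumberTheory.EllipticCurves.Kim2022_card_selmerGroup_le_pow_of_kuriharaNumber_ne_zero)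
    (hnf : exists_isNewformOf) (hMaz : mazur_not_dvd_maninConstant_of_odd)
    (W₀ : WeierstrassCurve ℤ) [(W₀.map (Int.castRingHom ℚ)).IsElliptic]
    [(W₀.map (Int.castRingHom ℚ)).IsGloballyMinimal] (p : ℕ) [hp : Fact p.Prime] (h5 : 5 ≤ p)
    (hgood : (W₀.map (Int.castRingHom ℚ)).HasGoodReductionAtPrime p)
    (hord : ¬ (p : ℤ) ∣ (W₀.map (Int.castRingHom ℚ)).frobeniusTrace p)
    (hsur : (W₀.map (Int.castRingHom ℚ)).HasSurjectiveModNGaloisRep p) (k : ℕ)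
    (hcert : ∀ z : ℕ, z < p ^ k →
      PrePsiEval.prePsi (W₀.map (Int.castRingHom (ZMod (p ^ k)))) (z : ZMod (p ^ k)) p ≠ 0)
    (hKN : ∀ v : HeightOneSpectrum (𝓞 ℚ), (W₀.map (Int.castRingHom ℚ)).HasMultiplicativeReductionAt v →
      ¬ p ∣ (W₀.map (Int.castRingHom ℚ)).ordMinimalDiscriminant v)
    [iNZ : NeZero ((W₀.map (Int.castRingHom ℚ)).conductorNorm ℤ)] (n : ℕ) [NeZero n]
    (hn : IsCyclicKolyvaginLevel (W₀.map (Int.castRingHom ℚ)) p n)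
    (hν : n.primeFactors.card ≤ (W₀.map (Int.castRingHom ℚ)).mordellWeilRank)
    (hδ : ∀ (D : ModularParametrizationData (W₀.map (Int.castRingHom ℚ))
        ((W₀.map (Int.castRingHom ℚ)).conductorNorm ℤ)), ¬ (p : ℤ) ∣ D.maninConstant →
      (∃ u : ℚ, ‖(u : ℚ_[p])‖ = 1 ∧ (W₀.map (Int.castRingHom ℚ)).realPeriodRat = u * plusPeriod D.f) →
      ∃ ψ : (ℓ : ℕ) → (ZMod ℓ)ˣ →* Multiplicative (ZMod p),
        (∀ ℓ ∈ n.primeFactors, Function.Surjective (ψ ℓ)) ∧ kuriharaNumber D.f p n ψ ≠ 0) :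
    ((W₀.map (Int.castRingHom ℚ)).sha ⊓
        AddSubgroup.torsionBy (W₀.map (Int.castRingHom ℚ)).galH1 (p : ℤ) : AddSubgroup _) = ⊥ :=
  sha_inf_torsionBy_eq_bot_of_kuriharaClaim_of_localTorsionTrivial hKim hnf hMaz _ p h5 hgood hord hsur
    (localTorsionTrivial_of_certificate_zmod W₀ p (by omega) k hcert) hKN n hn hν hδ

end Summit.BirchSwinnertonDyer.BirchSwinnertonDyer.Theorems.KolyvaginDepthDoor

end
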